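import Summits.AtomisticToContinuum.BoseEinsteinCondensation.Theses.BECHardSphereReduction
import Summits.AtomisticToContinuum.BoseEinsteinCondensation.Theorems.BECHardSphereReductionZeroModeGlue
import Summits.AtomisticToContinuum.BoseEinsteinCondensation.Theorems.BECHardSphereReductionHardSphereScaling
import Summits.AtomisticToContinuum.BoseEinsteinCondensation.Theorems.BECHardSphereReductionZeroModeNonVacuity
import Summits.AtomisticToContinuum.BoseEinsteinCondensation.Theorems.BECHardSphereReductionHardSphereBECStubSmoothSectors
import Summits.AtomisticToContinuum.BoseEinsteinCondensation.Theorems.BECHardSphereReductionHardSphereBECStubSectorTransferOf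

/-!
# Crux `HardSphereBEC` (stmt-11885), line `birth` v5 — the PHASE-SECTOR POSITIVITY TRANSFER assembled,
# and the crux / item 11888 reduced to MAJORITY zero-mode condensation of the nonnegative near-minimisers

Route `BECHardSphereReduction`, lead c8 (2026-08-17).  `HS₁ = ⊤·1_{[0,1]}`, `L_N(η) = (N/η)^{1/3}`,
`φ₀ = L^{-3/2}·1_{Λ_L}`, `occ₀(Θ) = ⟨φ₀, γ_Θ φ₀⟩`.

Every positivity method for the dilute Bose gas controls the zero-mode occupation of NONNEGATIVE
near-minimisers only; the passage to ALL near-minimisers used to be routed through phase rigidity of the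
near-ground states (the shared crux `GroundStateRigidity`, stmt-9072; for hard cores ⟸ `CubeConnected`).
The phase-sector argument of skeleton v5 shows that NO rigidity is needed once the nonnegative zero-mode
fraction exceeds `1/2`: a near-minimiser `Ψ` splits into its four phase sectors `(Re Ψ)±`, `(Im Ψ)±`;
slice-wise `|∫φ₀u|² + (∫φ₀|u|)² ≥ 2 Σ_j (∫φ₀ P_j)²` (norm of a vector integral ≤ integral of the norm), so
`occ₀(Ψ) + N ≥ 2 Σ_j occ₀(P_j)` (`stub_sectorOccupation`, p164230); each sector, smoothed
(`stub_smoothSectors`, p165003) and normalised, is again a near-minimiser because the four smoothed sectors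
are dominated IN SUM by `Ψ` in kinetic density and modulus; hence a bound `occ₀ ≥ cN` on the nonnegative
`δ₁`-near-minimisers gives `occ₀ ≥ (c − 1/2)N` on all `δ₂`-near-minimisers (`stub_sectorTransfer_of`,
p166374 + p166621; the sharp constant is `2c − 1`: two `Y`-overlapping components in antiphase).

* `phaseSectorTransfer` — the transfer as a closed theorem: every pair potential `v : ℝ → ℝ≥0∞` (no
  measurability, hard cores allowed), every `(N, L)` with `L > 0` and `E₀(v,N,L) < ⊤`, every `c > 1/2`.
* `hardSphereZeroMode_of_majorityPositiveZeroMode` — **item 11888 `HardSphereZeroMode` ⟸ S1⁺**, the one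
  registered stub of skeleton v5 (`stub_majorityPositiveZeroMode`: `∃ c > 1/2, ∃ η₁ > 0, ∀ η ∈ (0,η₁), ∀ᶠ N,
  ∃ δ > 0`, every nonnegative `δ`-near-minimiser of the HS₁ energy at `L_N(η)` has `occ₀ ≥ cN`), using
  `E₀(HS₁, N, L_N η) < ⊤` eventually for `η < 1/8` (`eventually_groundStateEnergy_hardSphere_lt_top`).
* `hardSphereBEC_of_majorityPositiveZeroMode` — **the crux ⟸ S1⁺** (with the PROVED scale covariance
  `hardSphereScaling_proof` through `hardSphereBEC_of_zeroMode_of_scaling`, p97804).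
-/

noncomputable section

namespace Summit.AtomisticToContinuum.BoseEinsteinCondensation.Cruxes.HardSphereBEC.MajorityReduction

open MeasureTheory ENNReal Filter Literature.MathematicalPhysics.QuantumManyBody.BoseGas
open Summit.AtomisticToContinuum.BoseEinsteinCondensation.Theses.BECHardSphereReduction
open Summit.AtomisticToContinuum.BoseEinsteinCondensation.Theorems

/-- **The phase-sector positivity transfer** (rigidity-free, every `v`, every `(N, L)` with `L > 0` and
finite ground-state energy): if `c > 1/2` and every NONNEGATIVE `δ₁`-near-minimiser `Φ` of the Dirichlet
energy has `⟨φ₀, γ_Φ φ₀⟩ ≥ cN`, then for some `δ₂ > 0` EVERY `δ₂`-near-minimiser `Ψ` has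
`⟨φ₀, γ_Ψ φ₀⟩ ≥ (c − 1/2)N`.  Assembled from the three landed stubs of skeleton v5
(`stub_sectorTransfer_of stub_sectorOccupation stub_smoothSectors`). [folklore] -/
theorem phaseSectorTransfer :
    ∀ (v : ℝ → ENNReal) (N : ℕ) (L : ℝ) (c : ℝ) (δ₁ : ENNReal), 1 / 2 < c → 0 < L → Literature.MathematicalPhysics.QuantumManyBody.BoseGas.groundStateEnergy v N L ≠ ⊤ → 0 < δ₁ → (∀ Φ : Literature.MathematicalPhysics.QuantumManyBody.BoseGas.TrialState N L, Literature.MathematicalPhysics.QuantumManyBody.BoseGas.energy v Φ ≤ Literature.MathematicalPhysics.QuantumManyBody.BoseGas.groundStateEnergy v N L + δ₁ → (∀ X, Φ.ψ X = (‖Φ.ψ X‖ : ℂ)) → ENNReal.ofReal (c * N) ≤ Literature.MathematicalPhysics.QuantumManyBody.BoseGas.occupation N ((Literature.MathematicalPhysics.QuantumManyBody.BoseGas.box L).indicator fun _ => ((Real.sqrt (L ^ 3))⁻¹ : ℂ)) Φ.ψ) → ∃ δ₂ : ENNReal, 0 < δ₂ ∧ ∀ Ψ : Literature.MathematicalPhysics.QuantumManyBody.BoseGas.TrialState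 N L, Literature.MathematicalPhysics.QuantumManyBody.BoseGas.energy v Ψ ≤ Literature.MathematicalPhysics.QuantumManyBody.BoseGas.groundStateEnergy v N L + δ₂ → ENNReal.ofReal ((c - 1 / 2) * N) ≤ Literature.MathematicalPhysics.QuantumManyBody.BoseGas.occupation N ((Literature.MathematicalPhysics.QuantumManyBody.BoseGas.box L).indicator fun _ => ((Real.sqrt (L ^ 3))⁻¹ : ℂ)) Ψ.ψ :=
  Birth.stub_sectorTransfer_of Birth.stub_sectorOccupation Birth.stub_smoothSectors

/-- **Item 11888 `HardSphereZeroMode` from MAJORITY zero-mode condensation of the nonnegative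
near-minimisers** (S1⁺, the registered physics kernel of skeleton v5): below `η₁' := min η₁ (1/8)` the
hard-sphere Dirichlet ground-state energy along `L_N(η)` is eventually finite (Ruelle), so the phase-sector
transfer applies at every large `N` with the slack of the majority bound and yields the constant
`c − 1/2 > 0` for ALL near-minimisers. [folklore] -/
theorem hardSphereZeroMode_of_majorityPositiveZeroMode
    (h1 : ∃ c : ℝ, 1 / 2 < c ∧ ∃ η₁ : ℝ, 0 < η₁ ∧ ∀ η : ℝ, 0 < η → η < η₁ → ∀ᶠ N : ℕ in Filter.atTop, ∃ δ : ENNReal, 0 < δ ∧ ∀ Φ : Literature.MathematicalPhysics.QuantumManyBody.BoseGas.TrialState N (Literature.MathematicalPhysics.QuantumManyBody.BoseGas.sideLength η N), Literature.MathematicalPhysics.QuantumManyBody.BoseGas.energy (Set.indicator (Set.Iic 1) (fun _ : ℝ => (⊤ : ENNReal))) Φ ≤ Literature.MathematicalPhysics.QuantumManyBody.BoseGas.groundStateEnergy (Set.indicator (Set.Iic 1) (fun _ : ℝ => (⊤ : ENNReal))) N (Literature.MathematicalPhysics.QuantumManyBody.BoseGas.sideLength η N) + δ → (∀ X, Φ.ψ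 X = (‖Φ.ψ X‖ : ℂ)) → ENNReal.ofReal (c * N) ≤ Literature.MathematicalPhysics.QuantumManyBody.BoseGas.occupation N ((Literature.MathematicalPhysics.QuantumManyBody.BoseGas.box (Literature.MathematicalPhysics.QuantumManyBody.BoseGas.sideLength η N)).indicator fun _ => ((Real.sqrt (Literature.MathematicalPhysics.QuantumManyBody.BoseGas.sideLength η N ^ 3))⁻¹ : ℂ)) Φ.ψ) :
    HardSphereZeroMode := by
  obtain ⟨c, hc, η₁, hη₁, H⟩ := h1
  refine ⟨min η₁ (1 / 8), lt_min hη₁ (by norm_num), fun η hη hηlt => ?_⟩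
  have hη1 : η < η₁ := hηlt.trans_le (min_le_left _ _)
  have hη8 : η < 1 / 8 := hηlt.trans_le (min_le_right _ _)
  refine ⟨c - 1 / 2, by linarith, ?_⟩
  filter_upwards [H η hη hη1, eventually_groundStateEnergy_hardSphere_lt_top hη hη8,
    eventually_gt_atTop 0] with N hN hE hN0
  obtain ⟨δ₁, hδ₁, hΦ⟩ := hN
  have hL : 0 < sideLength η N :=
    Real.rpow_pos_of_pos (div_pos (Nat.cast_pos.mpr hN0) hη) _
  exact phaseSectorTransfer _ N _ c δ₁ hc hL hE.ne hδ₁ hΦ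

/-- **The crux `HardSphereBEC` from S1⁺**: majority zero-mode condensation of the nonnegative
near-minimisers of the unit-hard-sphere energy gives `HardSphereZeroMode`
(`hardSphereZeroMode_of_majorityPositiveZeroMode`) and, with the PROVED exact scale covariance
`hardSphereScaling_proof`, dilute hard-sphere BEC for every diameter
(`hardSphereBEC_of_zeroMode_of_scaling`).  The closure of the crux is thereby reduced to ONE statement
about positive states. [folklore] -/
theorem hardSphereBEC_of_majorityPositiveZeroMode
    (h1 : ∃ c : ℝ, 1 / 2 < c ∧ ∃ η₁ : ℝ, 0 < η₁ ∧ ∀ η : ℝ, 0 < η → η < η₁ → ∀ᶠ N : ℕ in Filter.atTop, ∃ δ : ENNReal, 0 < δ ∧ ∀ Φ : Literature.MathematicalPhysics.QuantumManyBody.BoseGas.TrialState N (Literature.MathematicalPhysics.QuantumManyBody.BoseGas.sideLength η N), Literature.MathematicalPhysics.QuantumManyBody.BoseGas.energy (Set.indicator (Set.Iic 1) (fun _ : ℝ => (⊤ : ENNReal))) Φ ≤ Literature.MathematicalPhysics.QuantumManyBody.BoseGas.groundStateEnergy (Set.indicator (Set.Iic 1) (fun _ : ℝ => (⊤ : ENNReal)))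 N (Literature.MathematicalPhysics.QuantumManyBody.BoseGas.sideLength η N) + δ → (∀ X, Φ.ψ X = (‖Φ.ψ X‖ : ℂ)) → ENNReal.ofReal (c * N) ≤ Literature.MathematicalPhysics.QuantumManyBody.BoseGas.occupation N ((Literature.MathematicalPhysics.QuantumManyBody.BoseGas.box (Literature.MathematicalPhysics.QuantumManyBody.BoseGas.sideLength η N)).indicator fun _ => ((Real.sqrt (Literature.MathematicalPhysics.QuantumManyBody.BoseGas.sideLength η N ^ 3))⁻¹ : ℂ)) Φ.ψ) :
    HardSphereBEC :=
  hardSphereBEC_of_zeroMode_of_scaling (hardSphereZeroMode_of_majorityPositiveZeroMode h1)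
    hardSphereScaling_proof

end Summit.AtomisticToContinuum.BoseEinsteinCondensation.Cruxes.HardSphereBEC.MajorityReduction

end
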